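import Summits.CriticalPhenomena.PercolationContinuityZ3.Theorems.Transplant.FKConnectivityAllQForestAdjacentFanTwo
import Summits.CriticalPhenomena.PercolationContinuityZ3.Theorems.Transplant.FKConnectivityAllQForestAdjacentSlice
import Summits.CriticalPhenomena.PercolationContinuityZ3.Theorems.Transplant.FKConnectivityAllQApexTools
import Literature.Probability.Percolation.KozmaNitzanSeparatingTriple
import HarnessLib

/-!
# Near-tight gadgets: leaves, component counting on a vertex set, and the (spanning tree, two-forest) dichotomy

Support file (`--supports stmt-CriticalPhenomena-4575`), FK sub-lane `prim-bschramm-fk-1` (gen 22) of the post-continuity programme;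
builds on p205010 (kernel theorem, internal audit signed; external expert review pending).  No definitions, no named facts, no sorries;
standard axioms.  Tools for the LOCALLY-CONNECTED THEOREM of the square-free adjacent forest Rayleigh node
(`AdjForestRayleighNoSqOn`, memo bschramm/FROM-fk-1-g21-SIGMA-EXCHANGE.md §3; files `…ForestNearTightEars*`).

* `eq_of_isolated_of_reachable`, `exists_mem_of_reachable` — an isolated vertex reaches only itself;
* **`reachable_sdiff_of_leaf`** — LEAF AVOIDANCE: if every pair of `X` at `w` is the single pair `ww'`, a connection between two
  vertices other than `w` survives the removal of `ww'`;
* **`ncard_add_card_image_eq`** — for a forest `X` whose pairs lie inside the finite vertex set `U`: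
  `|X| + #{components met by U} = |U|` (from `Fo ⟺ |ω| + k(ω) = |V|`, the vertices off `U` being singleton clusters);
* `reachable_of_card_image_le_one`, `reachable_or_of_card_image_le_two` — one class met ⇒ `U` pairwise joined; at most two
  classes met ⇒ among any three vertices of `U` two are joined;
* **`card_image_add_card_image_add_card_eq`** — THE NEAR-TIGHT COUNT: for a set `E ⊆ M` of free pairs inside `U` and a fibre
  pair `(ω, ω ∆ M)` of forests, `#{classes of ω ∩ E met by U} + #{classes of (ω ∆ M) ∩ E met by U} + |E| = 2|U|`;
* **`nearTight_dichotomy`** — hence if `2|U| ≤ |E| + 3` ("near-tight or denser"), one of the two inside classes joins `U`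
  pairwise (a spanning tree of `U` when `|E| = 2|U| − 3`) and the other joins two of any three vertices of `U` (at most two
  components).  This is the inside half of the near-tight gadget lemma of the memo (§3a); the outside half is never needed in
  the form of traces — the fan / ear arguments use only these two consequences.
[cite: Grimmett2006, §1.5 (p. 13)] [cite: Linusson2011, Prop. 2.6] [cite: SempleWelsh2008, Conj. 1.1 (p. 2)]
-/

noncomputable section

namespace Summit.CriticalPhenomena.PercolationContinuityZ3.Theorems
namespace FK

open Set Literature.Probability.LatticeModels Literature.Probability.Percolation
open scoped Classical symmDiff

variable {V : Type*} [Fintype V]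

/-! ### Isolated vertices and leaves -/

section Leaf

variable {X : BondConfig V}

omit [Fintype V] in
/-- An isolated vertex reaches only itself. [folklore] -/
theorem eq_of_isolated_of_reachable {c w : V} (hc : ∀ g ∈ X, c ∉ g) (h : (openGraph X).Reachable c w) : c = w := by
  by_contra hne
  exact not_reachable_of_isolated hc (Ne.symm hne) h

omit [Fintype V] in
/-- A vertex joined to a different vertex lies on some pair of the configuration. [folklore] -/
theorem exists_mem_of_reachable {p q : V} (h : (openGraph X).Reachable p q) (hpq : p ≠ q) : ∃ g ∈ X, p ∈ g := by
  by_contra hno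
  push Not at hno
  exact hpq (eq_of_isolated_of_reachable hno h)

omit [Fintype V] in
/-- **Leaf avoidance**: if every pair of `X` at `w` is the pair `ww'`, then two vertices other than `w` that are joined in `X`
are still joined in `X ∖ {ww'}` (a path between them cannot pass through the leaf `w`). [folklore] -/
theorem reachable_sdiff_of_leaf {w w' p q : V} (hw : ∀ g ∈ X, w ∈ g → g = s(w, w')) (hwp : w ≠ p) (hwq : w ≠ q)
    (h : (openGraph X).Reachable p q) : (openGraph (X \ {s(w, w')})).Reachable p q := by
  by_cases hz : s(w, w') ∈ X
  · have hback : insert s(w, w') (X \ {s(w, w')}) = X := by rw [insert_sdiff_singleton, insert_eq_of_mem hz]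
    rw [← hback, KNSep.reachable_insert_iff] at h
    have hiso : ∀ g ∈ X \ {s(w, w')}, w ∉ g := fun g hg hwg => hg.2 (hw g hg.1 hwg)
    rcases h with h | ⟨h, -⟩ | ⟨-, h⟩
    · exact h
    · exact absurd (eq_of_isolated_of_reachable hiso h.symm) hwp
    · exact absurd (eq_of_isolated_of_reachable hiso h) hwq
  · rwa [sdiff_singleton_eq_self hz]

end Leaf

/-! ### Components met by a vertex set -/

section Components

variable {X : BondConfig V} {U : Finset V}

/-- **`|X| + #{components met by U} = |U|`** for a forest `X` all of whose pairs lie inside `U` (the vertices off `U` are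
singleton clusters, so `k(X) = #{components met by U} + |V ∖ U|`, and `|X| + k(X) = |V|` on forests).
[cite: Grimmett2006, §1.5 (p. 13)] -/
theorem ncard_add_card_image_eq (hX : IsForestCfg X) (hU : ∀ g ∈ X, ∀ w ∈ g, w ∈ U) :
    X.ncard + (U.image (openGraph X).connectedComponentMk).card = U.card := by
  have h1 : X.ncard + clusterCount X ∅ = Fintype.card V := (isForestCfg_iff_ncard_add X).1 hX
  have hs : Function.Surjective (openGraph X).connectedComponentMk := fun c =>
    SimpleGraph.ConnectedComponent.ind (fun v => ⟨v, rfl⟩) c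
  have h2 : clusterCount X ∅ = (Finset.univ.image (openGraph X).connectedComponentMk).card := by
    unfold clusterCount
    rw [wired_empty, sup_bot_eq, Nat.card_eq_fintype_card, Finset.image_univ_of_surjective hs, Finset.card_univ]
  have hiso : ∀ w, w ∉ U → ∀ g ∈ X, w ∉ g := fun w hw g hg hwg => hw (hU g hg w hwg)
  have h3 : Finset.univ.image (openGraph X).connectedComponentMk =
      U.image (openGraph X).connectedComponentMk ∪ (Finset.univ \ U).image (openGraph X).connectedComponentMk := by
    rw [← Finset.image_union, Finset.union_sdiff_of_subset (Finset.subset_univ U)]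
  have hdisj : Disjoint (U.image (openGraph X).connectedComponentMk)
      ((Finset.univ \ U).image (openGraph X).connectedComponentMk) := by
    rw [Finset.disjoint_left]
    intro c hc hc'
    obtain ⟨u, hu, rfl⟩ := Finset.mem_image.1 hc
    obtain ⟨w, hw, hwu⟩ := Finset.mem_image.1 hc'
    have hwU : w ∉ U := (Finset.mem_sdiff.1 hw).2
    have hwu' : w = u := eq_of_isolated_of_reachable (hiso w hwU) (SimpleGraph.ConnectedComponent.exact hwu)
    exact hwU (hwu' ▸ hu)
  have hinj : Set.InjOn (openGraph X).connectedComponentMk ↑(Finset.univ \ U) := by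
    intro w hw w' _ h
    have hwU : w ∉ U := (Finset.mem_sdiff.1 (Finset.mem_coe.1 hw)).2
    exact eq_of_isolated_of_reachable (hiso w hwU) (SimpleGraph.ConnectedComponent.exact h)
  have h4 : (Finset.univ.image (openGraph X).connectedComponentMk).card =
      (U.image (openGraph X).connectedComponentMk).card + (Finset.univ \ U).card := by
    rw [h3, Finset.card_union_of_disjoint hdisj, Finset.card_image_of_injOn hinj]
  have h5 : (Finset.univ \ U).card + U.card = Fintype.card V := by
    rw [Finset.card_sdiff_add_card_eq_card (Finset.subset_univ U), Finset.card_univ]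
  omega

omit [Fintype V] in
/-- One class met by `U`: the vertices of `U` are pairwise joined. [folklore] -/
theorem reachable_of_card_image_le_one (h : (U.image (openGraph X).connectedComponentMk).card ≤ 1) {p q : V} (hp : p ∈ U)
    (hq : q ∈ U) : (openGraph X).Reachable p q :=
  SimpleGraph.ConnectedComponent.exact
    (Finset.card_le_one.1 h _ (Finset.mem_image_of_mem _ hp) _ (Finset.mem_image_of_mem _ hq))

omit [Fintype V] in
/-- At most two classes met by `U`: among any three vertices of `U`, two are joined. [folklore] -/
theorem reachable_or_of_card_image_le_two (h : (U.image (openGraph X).connectedComponentMk).card ≤ 2) {p q w : V}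
    (hp : p ∈ U) (hq : q ∈ U) (hw : w ∈ U) :
    (openGraph X).Reachable p q ∨ (openGraph X).Reachable p w ∨ (openGraph X).Reachable q w := by
  by_contra hno
  simp only [not_or] at hno
  obtain ⟨h1, h2, h3⟩ := hno
  have hne1 : (openGraph X).connectedComponentMk p ≠ (openGraph X).connectedComponentMk q :=
    fun h' => h1 (SimpleGraph.ConnectedComponent.exact h')
  have hne2 : (openGraph X).connectedComponentMk p ≠ (openGraph X).connectedComponentMk w :=
    fun h' => h2 (SimpleGraph.ConnectedComponent.exact h')
  have hne3 : (openGraph X).connectedComponentMk q ≠ (openGraph X).connectedComponentMk w :=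
    fun h' => h3 (SimpleGraph.ConnectedComponent.exact h')
  have hsub : ({(openGraph X).connectedComponentMk p, (openGraph X).connectedComponentMk q,
      (openGraph X).connectedComponentMk w} : Finset _) ⊆ U.image (openGraph X).connectedComponentMk := by
    intro c hc
    simp only [Finset.mem_insert, Finset.mem_singleton] at hc
    rcases hc with rfl | rfl | rfl
    · exact Finset.mem_image_of_mem _ hp
    · exact Finset.mem_image_of_mem _ hq
    · exact Finset.mem_image_of_mem _ hw
  have hcard : ({(openGraph X).connectedComponentMk p, (openGraph X).connectedComponentMk q,
      (openGraph X).connectedComponentMk w} : Finset _).card = 3 := by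
    rw [Finset.card_insert_of_notMem, Finset.card_insert_of_notMem, Finset.card_singleton]
    · simpa using hne3
    · simp only [Finset.mem_insert, Finset.mem_singleton, not_or]; exact ⟨hne1, hne2⟩
  have := Finset.card_le_card hsub
  omega

end Components

/-! ### The near-tight count and the dichotomy -/

section NearTight

variable {M ω : BondConfig V} {U : Finset V} {E : Finset (Sym2 V)}

omit [Fintype V] in
/-- The inside class of `ω`: `ω ∩ E` is the coercion of `E.filter (· ∈ ω)`. [folklore] -/
theorem inter_coe_eq_filter (ω : BondConfig V) (E : Finset (Sym2 V)) :
    ω ∩ (↑E : Set (Sym2 V)) = ↑(E.filter fun g => g ∈ ω) := by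
  ext g
  simp only [mem_inter_iff, Finset.mem_coe, Finset.mem_filter]
  tauto

omit [Fintype V] in
/-- The inside class of the partner: for `E ⊆ M`, `(ω ∆ M) ∩ E` is the coercion of `E.filter (· ∉ ω)`. [folklore] -/
theorem symmDiff_inter_coe_eq_filter (hEM : ∀ g ∈ E, g ∈ M) :
    (ω ∆ M) ∩ (↑E : Set (Sym2 V)) = ↑(E.filter fun g => g ∉ ω) := by
  ext g
  simp only [mem_inter_iff, Finset.mem_coe, Finset.mem_filter, Set.mem_symmDiff]
  constructor
  · rintro ⟨⟨hgω, hgM⟩ | ⟨-, hgω⟩, hgE⟩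
    · exact absurd (hEM g hgE) hgM
    · exact ⟨hgE, hgω⟩
  · rintro ⟨hgE, hgω⟩
    exact ⟨Or.inr ⟨hEM g hgE, hgω⟩, hgE⟩

/-- **THE NEAR-TIGHT COUNT**: for free pairs `E ⊆ M` inside `U` and a fibre pair `(ω, ω ∆ M)` of forests,
`#{classes of ω ∩ E met by U} + #{classes of (ω ∆ M) ∩ E met by U} + |E| = 2|U|` (the two inside classes partition `E`, and
each satisfies `|class| + #{its classes met by U} = |U|`). [cite: Grimmett2006, §1.5 (p. 13)] [cite: Linusson2011, Prop. 2.6] -/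
theorem card_image_add_card_image_add_card_eq (hEM : ∀ g ∈ E, g ∈ M) (hEU : ∀ g ∈ E, ∀ w ∈ g, w ∈ U) (hA : IsForestCfg ω)
    (hB : IsForestCfg (ω ∆ M)) :
    (U.image (openGraph (ω ∩ ↑E)).connectedComponentMk).card + (U.image (openGraph ((ω ∆ M) ∩ ↑E)).connectedComponentMk).card +
      E.card = 2 * U.card := by
  have h1 := ncard_add_card_image_eq (U := U) (isForestCfg_of_subset hA (inter_subset_left (t := (↑E : Set (Sym2 V)))))
    fun g hg w hw => hEU g hg.2 w hw
  have h2 := ncard_add_card_image_eq (U := U) (isForestCfg_of_subset hB (inter_subset_left (t := (↑E : Set (Sym2 V)))))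
    fun g hg w hw => hEU g hg.2 w hw
  have n1 : (ω ∩ (↑E : Set (Sym2 V))).ncard = (E.filter fun g => g ∈ ω).card := by
    rw [inter_coe_eq_filter, Set.ncard_coe_finset]
  have n2 : ((ω ∆ M) ∩ (↑E : Set (Sym2 V))).ncard = (E.filter fun g => g ∉ ω).card := by
    rw [symmDiff_inter_coe_eq_filter hEM, Set.ncard_coe_finset]
  have n3 : (E.filter fun g => g ∈ ω).card + (E.filter fun g => g ∉ ω).card = E.card :=
    Finset.card_filter_add_card_filter_not _
  omega

/-- **THE (SPANNING TREE, TWO-FOREST) DICHOTOMY of a near-tight inside set**: if the free pairs `E ⊆ M` lie inside `U` and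
`2|U| ≤ |E| + 3`, then for every fibre pair `(ω, ω ∆ M)` of forests one inside class joins the vertices of `U` pairwise and the
other joins two of any three vertices of `U` (for `|E| = 2|U| − 3`: one class is a spanning tree of `U`, the other a spanning
two-forest; the denser cases are degenerate).  Memo bschramm/FROM-fk-1-g21-SIGMA-EXCHANGE.md §3a.
[cite: Grimmett2006, §1.5 (p. 13)] [cite: Linusson2011, Prop. 2.6] -/
theorem nearTight_dichotomy (hEM : ∀ g ∈ E, g ∈ M) (hEU : ∀ g ∈ E, ∀ w ∈ g, w ∈ U) (hcard : 2 * U.card ≤ E.card + 3)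
    (hA : IsForestCfg ω) (hB : IsForestCfg (ω ∆ M)) :
    ((∀ p ∈ U, ∀ q ∈ U, (openGraph (ω ∩ ↑E)).Reachable p q) ∧
      (∀ p ∈ U, ∀ q ∈ U, ∀ w ∈ U, (openGraph ((ω ∆ M) ∩ ↑E)).Reachable p q ∨
        (openGraph ((ω ∆ M) ∩ ↑E)).Reachable p w ∨ (openGraph ((ω ∆ M) ∩ ↑E)).Reachable q w)) ∨
    ((∀ p ∈ U, ∀ q ∈ U, (openGraph ((ω ∆ M) ∩ ↑E)).Reachable p q) ∧
      (∀ p ∈ U, ∀ q ∈ U, ∀ w ∈ U, (openGraph (ω ∩ ↑E)).Reachable p q ∨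
        (openGraph (ω ∩ ↑E)).Reachable p w ∨ (openGraph (ω ∩ ↑E)).Reachable q w)) := by
  have hsum := card_image_add_card_image_add_card_eq (U := U) hEM hEU hA hB
  by_cases hU : U = ∅
  · subst hU
    exact Or.inl ⟨fun p hp => absurd hp (Finset.notMem_empty p), fun p hp => absurd hp (Finset.notMem_empty p)⟩
  obtain ⟨u, hu⟩ := Finset.nonempty_iff_ne_empty.2 hU
  have m1 : 1 ≤ (U.image (openGraph (ω ∩ ↑E)).connectedComponentMk).card :=
    Finset.card_pos.2 ⟨_, Finset.mem_image_of_mem _ hu⟩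
  have m2 : 1 ≤ (U.image (openGraph ((ω ∆ M) ∩ ↑E)).connectedComponentMk).card :=
    Finset.card_pos.2 ⟨_, Finset.mem_image_of_mem _ hu⟩
  by_cases h1 : (U.image (openGraph (ω ∩ ↑E)).connectedComponentMk).card ≤ 1
  · refine Or.inl ⟨fun p hp q hq => reachable_of_card_image_le_one h1 hp hq, fun p hp q hq w hw => ?_⟩
    exact reachable_or_of_card_image_le_two (by omega) hp hq hw
  · refine Or.inr ⟨fun p hp q hq => reachable_of_card_image_le_one (by omega) hp hq, fun p hp q hq w hw => ?_⟩
    exact reachable_or_of_card_image_le_two (by omega) hp hq hw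

end NearTight

end FK
end Summit.CriticalPhenomena.PercolationContinuityZ3.Theorems

end
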